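import Mathlib
import Literature.MathematicalPhysics.QuantumFieldTheory.OSSectorContinuation
import Summits.QuantumFields.YangMills.Theorems.MirrorModularBoostsPlanarSpectralConeDiscSections
import Summits.QuantumFields.YangMills.Theorems.MirrorModularBoostsPlanarSpectralConeComplexTimeSlot
import HarnessLib

/-!
# Disc sections of a planar kernel from its two diagonal Laplace–Fourier slots
(stub `stub_planarDiscSections`, crux `PencilRigidity.ShellRigidity`)

Line `transverse-smearing-planar-threshold` of crux `PencilRigidity.ShellRigidity`
(stmt-QuantumFields-11685).

Informal statement. Let `F : ℝ² → ℝ` be continuous off the origin and `D₄`-symmetric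
(`F(t,s) = F(s,t) = F(t,-s) = F(-t,s)`), and suppose its light-cone transform
`Φ(u,v) = F((u+v)/√2, (u-v)/√2)` has, for every shift `ε₀ > 0`, a Laplace–Fourier representation
`Φ(ε₀ + u, v) = ∫ e^{-u p₀ + i v p₁} dμ_{ε₀}(p)` (`u ≥ 0`, `v ∈ ℝ`) by a finite measure `μ_{ε₀}` on
`ℝ⁴` carried by `{p₀ ≥ 0}`. Then for every `ε > 0` there is `M` (namely `μ_{ε/√2}(ℝ⁴)`) such that
for every `t > 0` the function `b ↦ F(ε + t, b)` on `(-t, t)` is the restriction of a function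
holomorphic on the disc `|β| < t` and bounded by `M` there.

Proof. Put `ε₀ = ε/√2` and `S(u₀,u₁) = Φ(u₀ + ε₀, u₁ + ε₀) = F((u₀+u₁)/√2 + ε, (u₀-u₁)/√2)` on the
open quadrant. In the variable `u₀` (at fixed `u₁ > 0`) `S` is the restriction of the
Laplace–Fourier transform `τ ↦ ∫ e^{-τ p₀ + i (u₁+ε₀) p₁} dμ_{ε₀}`, holomorphic on `Re τ > 0`,
continuous in `u₁`, bounded by `M = μ_{ε₀}(ℝ⁴)`; since `Φ(u,v) = Φ(v,u)` (this is
`F(t,s) = F(t,-s)`), the same holds in the variable `u₁`. These are exactly sector data of opening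
`π/2` and polynomial degree `0` for the tree's sector engine (Osterwalder–Schrader's (5.8),
`LogSlot.IsSectorData.exists_extension`), which continues `S` to `G` holomorphic on the two-slot
sector region `{Re w₀, Re w₁ > 0, |arg w₀| + |arg w₁| < π/2}`, and the maximum principle on the
flat tubes (`LogSlot.IsSectorData.norm_extension_le`, at every opening `c < π/2`) bounds `G` by `M`
there. By Thales (`DiscSections.lightCone_mem_sectorRegion`) the light-cone coordinates
`((t+β)/√2, (t-β)/√2)` of the disc `|β| < t` lie in that region, so
`f(β) = G((t+β)/√2, (t-β)/√2)` is holomorphic and bounded by `M` on the disc, and at real `|b| < t`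
it equals `S((t+b)/√2, (t-b)/√2) = F(t + ε, b)`.

References: K. Osterwalder, R. Schrader, Comm. Math. Phys. 42 (1975), Ch. V (5.7)–(5.8) and
Ch. VI.2 (6.15) (sector continuation and the maximum principle, both PROVED in
`Literature/MathematicalPhysics/QuantumFieldTheory/OSSectorContinuation.lean`); the Thales slice is
folklore (sibling file `MirrorModularBoostsPlanarSpectralConeDiscSections`).
-/

noncomputable section

namespace Summit.QuantumFields.YangMills.Cruxes.ShellRigidity.TransverseSmearingPlanarThreshold

open MeasureTheory Complex Set Filter
open scoped InnerProductSpace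
open Summit.QuantumFields.YangMills.Cruxes.PlanarSpectralCone.TwoMirrorLightconeSlots
open Literature.MathematicalPhysics.QuantumFieldTheory

/-! ## Helpers

They live in the sub-namespace `PlanarDiscSections` (no collisions with sibling stub files). -/

namespace PlanarDiscSections

/-- `⟪c e₁, p⟫ = c p₁` on `ℝ⁴`. -/
theorem inner_smul_single_one (c : ℝ) (p : EuclideanSpace ℝ (Fin 4)) :
    ⟪c • (EuclideanSpace.single 1 (1 : ℝ) : EuclideanSpace ℝ (Fin 4)), p⟫_ℝ = c * p 1 := by
  rw [real_inner_smul_left, EuclideanSpace.inner_single_left]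
  simp

/-- The shift `u' ↦ (u'₀ + ε₀) e₁` is continuous. -/
theorem continuous_shift (ε₀ : ℝ) :
    Continuous fun u' : Fin 1 → ℝ =>
      (u' 0 + ε₀) • (EuclideanSpace.single 1 (1 : ℝ) : EuclideanSpace ℝ (Fin 4)) :=
  ((continuous_apply 0).add continuous_const).smul continuous_const

/-- The light-cone shift: `(ε/√2 + x + (v + ε/√2))/√2 = (x + v)/√2 + ε`. -/
theorem shift_sum (ε x v : ℝ) :
    (ε / Real.sqrt 2 + x + (v + ε / Real.sqrt 2)) / Real.sqrt 2 = (x + v) / Real.sqrt 2 + ε := by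
  have h2 : Real.sqrt 2 * Real.sqrt 2 = 2 := Real.mul_self_sqrt two_pos.le
  have key : (ε / Real.sqrt 2 + ε / Real.sqrt 2) / Real.sqrt 2 = ε := by
    rw [← add_div, div_div, h2]
    ring
  calc (ε / Real.sqrt 2 + x + (v + ε / Real.sqrt 2)) / Real.sqrt 2
      = (x + v) / Real.sqrt 2 + (ε / Real.sqrt 2 + ε / Real.sqrt 2) / Real.sqrt 2 := by ring
    _ = (x + v) / Real.sqrt 2 + ε := by rw [key]

/-- The light-cone shift, second coordinate: `(ε/√2 + x - (v + ε/√2))/√2 = (x - v)/√2`. -/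
theorem shift_sub (ε x v : ℝ) :
    (ε / Real.sqrt 2 + x - (v + ε / Real.sqrt 2)) / Real.sqrt 2 = (x - v) / Real.sqrt 2 := by
  ring

/-- Coordinates of `Fin.insertNth 0 x u'` in `Fin 2`. -/
theorem insertNth_zero_apply (x : ℝ) (u' : Fin 1 → ℝ) :
    Fin.insertNth (α := fun _ : Fin 2 => ℝ) 0 x u' 0 = x ∧
      Fin.insertNth (α := fun _ : Fin 2 => ℝ) 0 x u' 1 = u' 0 :=
  ⟨Fin.insertNth_apply_same (α := fun _ : Fin 2 => ℝ) 0 x u',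
    Fin.insertNth_apply_succAbove (α := fun _ : Fin 2 => ℝ) 0 x u' 0⟩

/-- Coordinates of `Fin.insertNth 1 x u'` in `Fin 2`. -/
theorem insertNth_one_apply (x : ℝ) (u' : Fin 1 → ℝ) :
    Fin.insertNth (α := fun _ : Fin 2 => ℝ) 1 x u' 0 = u' 0 ∧
      Fin.insertNth (α := fun _ : Fin 2 => ℝ) 1 x u' 1 = x :=
  ⟨Fin.insertNth_apply_succAbove (α := fun _ : Fin 2 => ℝ) 1 x u' 0,
    Fin.insertNth_apply_same (α := fun _ : Fin 2 => ℝ) 1 x u'⟩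

/-- Every point of the sector region of opening `a` lies in a sector region of some opening
`0 < c < a`. -/
theorem exists_opening_lt {m : ℕ} {a : ℝ} (ha : 0 < a) {w : Fin (m + 1) → ℂ}
    (hw : w ∈ Literature.Analysis.Complex.sectorRegion m a) :
    ∃ c : ℝ, 0 < c ∧ c < a ∧ w ∈ Literature.Analysis.Complex.sectorRegion m c := by
  have hs : 0 ≤ ∑ j, |Complex.arg (w j)| := Finset.sum_nonneg fun j _ => abs_nonneg _
  refine ⟨(∑ j, |Complex.arg (w j)| + a) / 2, by linarith [hw.2], by linarith [hw.2], hw.1, ?_⟩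
  linarith [hw.2]

/-- **The sector engine at degree `0`.** Sector data of opening `π/2` with `S` and all slots bounded
by one constant `M` continue to a function holomorphic on the two-slot sector region of opening
`π/2`, bounded by `M` there, and equal to `S` at the positive real points
(`IsSectorData.exists_extension` + the maximum principle `IsSectorData.norm_extension_le` at every
opening `c < π/2`). -/
theorem exists_bounded_extension {m : ℕ} {S : (Fin (m + 1) → ℝ) → ℂ}
    {E : Fin (m + 1) → (Fin m → ℝ) → ℂ → ℂ} {M : ℝ}
    (hdata : LogSlot.IsSectorData (Real.pi / 2) S E M 0 (fun _ => M))
    (hMS : ∀ u : Fin (m + 1) → ℝ, (∀ j, 0 < u j) → ‖S u‖ ≤ M)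
    (hME : ∀ (i : Fin (m + 1)) (u' : Fin m → ℝ) (τ : ℂ), (∀ j, 0 < u' j) → 0 < τ.re →
      ‖E i u' τ‖ ≤ M) :
    ∃ G : (Fin (m + 1) → ℂ) → ℂ,
      DifferentiableOn ℂ G (Literature.Analysis.Complex.sectorRegion m (Real.pi / 2)) ∧
      (∀ w ∈ Literature.Analysis.Complex.sectorRegion m (Real.pi / 2), ‖G w‖ ≤ M) ∧
      ∀ u : Fin (m + 1) → ℝ, (∀ j, 0 < u j) → G (fun j => (u j : ℂ)) = S u := by
  obtain ⟨G, hGd, hGreal⟩ := hdata.exists_extension Real.pi_div_two_pos le_rfl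
  refine ⟨G, hGd, fun w hw => ?_, hGreal⟩
  obtain ⟨c, hc0, hca, hwc⟩ := exists_opening_lt Real.pi_div_two_pos hw
  exact hdata.norm_extension_le le_rfl hGd hGreal hc0 hca hMS
    (fun i u' τ hu hτ _ => hME i u' τ hu hτ) hwc

/-- **Thales read-back.** If `G` is holomorphic on the two-slot sector region of opening `π/2`,
bounded by `M` there, and `G((t+b)/√2, (t-b)/√2) = F(ε + t, b)` at the real light-cone points of
`|b| < t`, then `f(β) = G((t+β)/√2, (t-β)/√2)` is a disc section of `b ↦ F(ε+t, b)` bounded by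
`M`. -/
theorem discSection_of_extension (F : ℝ × ℝ → ℝ) (ε : ℝ) {M : ℝ} {G : (Fin 2 → ℂ) → ℂ}
    (hGd : DifferentiableOn ℂ G (Literature.Analysis.Complex.sectorRegion 1 (Real.pi / 2)))
    (hGb : ∀ w ∈ Literature.Analysis.Complex.sectorRegion 1 (Real.pi / 2), ‖G w‖ ≤ M)
    {t : ℝ} (hGr : ∀ b : ℝ, |b| < t →
      G (fun j => (((![(t + b) / Real.sqrt 2, (t - b) / Real.sqrt 2] : Fin 2 → ℝ) j : ℝ) : ℂ)) =
        ((F (ε + t, b) : ℝ) : ℂ)) :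
    ∃ f : ℂ → ℂ, DifferentiableOn ℂ f (Metric.ball 0 t) ∧
      (∀ z ∈ Metric.ball (0 : ℂ) t, ‖f z‖ ≤ M) ∧
      ∀ b : ℝ, |b| < t → f b = ((F (ε + t, b) : ℝ) : ℂ) := by
  -- the light-cone coordinate map of the slice `ζ = t`
  set g : ℂ → (Fin 2 → ℂ) := fun β =>
    (![((t : ℂ) + β) / (Real.sqrt 2 : ℂ), ((t : ℂ) - β) / (Real.sqrt 2 : ℂ)] : Fin 2 → ℂ) with hg
  have hmaps : MapsTo g (Metric.ball (0 : ℂ) t)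
      (Literature.Analysis.Complex.sectorRegion 1 (Real.pi / 2)) := by
    intro β hβ
    rw [Metric.mem_ball, dist_zero_right] at hβ
    exact DiscSections.lightCone_mem_sectorRegion hβ
  have hgd : Differentiable ℂ g := DiscSections.differentiable_lightCone t
  refine ⟨G ∘ g, hGd.comp hgd.differentiableOn hmaps, fun z hz => hGb _ (hmaps hz), ?_⟩
  intro b hb
  have hgb : g b = fun j =>
      (((![(t + b) / Real.sqrt 2, (t - b) / Real.sqrt 2] : Fin 2 → ℝ) j : ℝ) : ℂ) :=
    DiscSections.lightCone_ofReal t b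
  show G (g b) = _
  rw [hgb, hGr b hb]

end PlanarDiscSections

/-! ## The stub -/

/-- **Stub 5 · disc sections from the two diagonal slots** (the tree's sector engine + Thales).
`hΦ` represents the light-cone transform `Φ(u,v) = F((u+v)/√2, (u-v)/√2)` in its axis frame:
for every `ε₀ > 0` a finite measure with `Φ(ε₀ + u, v) = ∫ e^{-u p₀ + i v p₁} dμ` (`u ≥ 0`). With
`ε₀ = ε/√2`: `S(u₀,u₁) = Φ(u₀ + ε₀, u₁ + ε₀) = F((u₀+u₁)/√2 + ε, (u₀-u₁)/√2)` is continuous on the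
open quadrant and bounded by `M = μ(ℝ⁴)`; its two slots are the Laplace–Fourier integrals
`τ ↦ ∫ e^{-τ p₀ + i (u₁+ε₀) p₁} dμ` (holomorphic on `Re τ > 0`, continuous in `u₁`, bounded by `M`,
equal to `S` on the positive axis; `Φ(u,v) = Φ(v,u)` from `F(t,s) = F(t,-s)`;
`ComplexTimeSlot.exists_laplaceFourier`), i.e. `LogSlot.IsSectorData (π/2) S E M 0 (fun _ => M)`;
`exists_extension` + `norm_extension_le` (at every `c < π/2`) give `G` holomorphic and bounded by
`M` on `sectorRegion 1 (π/2)`; Thales (`DiscSections.lightCone_mem_sectorRegion`): `f β =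
G((t+β)/√2, (t-β)/√2)` is holomorphic on `|β| < t`, bounded by `M`, and
`f b = S((t+b)/√2,(t-b)/√2) = F(ε+t, b)`. -/
theorem stub_planarDiscSections (F : ℝ × ℝ → ℝ)
    (hc : ContinuousOn F {x | x ≠ 0})
    (hsym : ∀ t s : ℝ, F (t, s) = F (s, t) ∧ F (t, s) = F (t, -s) ∧ F (t, s) = F (-t, s))
    (hΦ : ∀ ε : ℝ, 0 < ε → ∃ μ : Measure (EuclideanSpace ℝ (Fin 4)), IsFiniteMeasure μ ∧
      μ {p | p 0 < 0} = 0 ∧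
      ∀ u : ℝ, 0 ≤ u → ∀ v : ℝ, ((F ((ε + u + v) / Real.sqrt 2, (ε + u - v) / Real.sqrt 2) : ℝ) : ℂ) =
        ∫ p, cexp ((((-(u * p 0) : ℝ)) : ℂ) + ((v * p 1 : ℝ) : ℂ) * I) ∂μ)
    (ε : ℝ) (hε : 0 < ε) :
    ∃ M : ℝ, ∀ t : ℝ, 0 < t → ∃ f : ℂ → ℂ, DifferentiableOn ℂ f (Metric.ball 0 t) ∧
      (∀ z ∈ Metric.ball (0 : ℂ) t, ‖f z‖ ≤ M) ∧
      ∀ b : ℝ, |b| < t → f b = ((F (ε + t, b) : ℝ) : ℂ) := by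
  have hs : 0 < Real.sqrt 2 := Real.sqrt_pos.2 two_pos
  -- the diagonal representation at the shift `ε₀ = ε/√2` and its Laplace–Fourier transform
  obtain ⟨μ, hfin, hE, hrep⟩ := hΦ (ε / Real.sqrt 2) (div_pos hε hs)
  haveI := hfin
  obtain ⟨g, hg_holo, hg_cont, hg_bd, hg_real⟩ := ComplexTimeSlot.exists_laplaceFourier μ hE
  -- the shifted light-cone transform `S` and its two (identical) slots `E`
  set S : (Fin 2 → ℝ) → ℂ := fun u =>
    ((F ((u 0 + u 1) / Real.sqrt 2 + ε, (u 0 - u 1) / Real.sqrt 2) : ℝ) : ℂ) with hS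
  set E : Fin 2 → (Fin 1 → ℝ) → ℂ → ℂ := fun _ u' τ =>
    g ((u' 0 + ε / Real.sqrt 2) • (EuclideanSpace.single 1 (1 : ℝ) : EuclideanSpace ℝ (Fin 4))) τ
    with hEdef
  -- the slots at real points are `S`
  have hslot : ∀ x : ℝ, 0 < x → ∀ v : ℝ,
      ((F ((x + v) / Real.sqrt 2 + ε, (x - v) / Real.sqrt 2) : ℝ) : ℂ) =
        g ((v + ε / Real.sqrt 2) •
          (EuclideanSpace.single 1 (1 : ℝ) : EuclideanSpace ℝ (Fin 4))) x := by
    intro x hx v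
    rw [← PlanarDiscSections.shift_sum ε x v, ← PlanarDiscSections.shift_sub ε x v,
      hrep x hx.le (v + ε / Real.sqrt 2), hg_real _ x hx]
    refine integral_congr_ae (ae_of_all _ fun p => ?_)
    simp only [PlanarDiscSections.inner_smul_single_one]
  -- `Φ(u,v) = Φ(v,u)`
  have hswap : ∀ x v : ℝ, F ((x + v) / Real.sqrt 2 + ε, (x - v) / Real.sqrt 2) =
      F ((v + x) / Real.sqrt 2 + ε, (v - x) / Real.sqrt 2) := by
    intro x v
    rw [(hsym ((v + x) / Real.sqrt 2 + ε) ((v - x) / Real.sqrt 2)).2.1, add_comm x v, ← neg_div,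
      neg_sub]
  -- the uniform bounds
  have hMS : ∀ u : Fin 2 → ℝ, (∀ j, 0 < u j) → ‖S u‖ ≤ μ.real Set.univ := by
    intro u hu
    simp only [hS]
    rw [hslot (u 0) (hu 0) (u 1)]
    exact hg_bd _ _ (by simpa using hu 0)
  have hME : ∀ (i : Fin 2) (u' : Fin 1 → ℝ) (τ : ℂ), (∀ j, 0 < u' j) → 0 < τ.re →
      ‖E i u' τ‖ ≤ μ.real Set.univ := fun i u' τ _ hτ => hg_bd _ τ hτ
  -- the sector data
  have hdata : LogSlot.IsSectorData (m := 1) (Real.pi / 2) S E (μ.real Set.univ) 0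
      (fun _ => μ.real Set.univ) := by
    refine ⟨?_, measureReal_nonneg, fun u hu => ?_, fun i τ hτ => ?_, fun i u' hu' => ?_,
      fun _ => measureReal_nonneg, fun i c hc u' τ hu' hτ hτc => ?_, fun i u' hu' x hx => ?_⟩
    · -- continuity on the open quadrant: the first planar argument is positive there
      have hφ : Continuous fun u : Fin 2 → ℝ =>
          ((u 0 + u 1) / Real.sqrt 2 + ε, (u 0 - u 1) / Real.sqrt 2) := by fun_prop
      refine Complex.continuous_ofReal.comp_continuousOn (hc.comp hφ.continuousOn fun u hu => ?_)
      have h0 : 0 < (u 0 + u 1) / Real.sqrt 2 + ε := by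
        have := hu 0; have := hu 1; positivity
      intro h
      have h1 := congrArg Prod.fst h
      simp only [Prod.fst_zero] at h1
      linarith
    · rw [pow_zero, mul_one]
      exact hMS u hu
    · exact (hg_cont τ hτ.1).comp_continuousOn
        (PlanarDiscSections.continuous_shift (ε / Real.sqrt 2)).continuousOn
    · exact (hg_holo _).mono fun τ hτ => hτ.1
    · rw [pow_zero, pow_zero, mul_one, mul_one]
      exact hg_bd _ τ hτ
    · -- real points: slot `0` directly, slot `1` through `Φ(u,v) = Φ(v,u)`
      simp only [hEdef, hS]
      fin_cases i
      · obtain ⟨h0, h1⟩ := PlanarDiscSections.insertNth_zero_apply x u'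
        simp only [Fin.zero_eta, Fin.isValue] at h0 h1 ⊢
        rw [h0, h1]
        exact (hslot x hx (u' 0)).symm
      · obtain ⟨h0, h1⟩ := PlanarDiscSections.insertNth_one_apply x u'
        simp only [Fin.mk_one, Fin.isValue] at h0 h1 ⊢
        rw [h0, h1, hswap (u' 0) x]
        exact (hslot x hx (u' 0)).symm
  -- the bounded extension and the Thales read-back
  obtain ⟨G, hGd, hGb, hGreal⟩ := PlanarDiscSections.exists_bounded_extension hdata hMS hME
  refine ⟨μ.real Set.univ, fun t _ht => ?_⟩
  refine PlanarDiscSections.discSection_of_extension F ε hGd hGb fun b hb => ?_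
  rw [hGreal _ (DiscSections.lightCone_real_pos hb)]
  simp only [hS, Matrix.cons_val_zero, Matrix.cons_val_one, Matrix.cons_val_fin_one]
  rw [DiscSections.lightCone_real_sum, DiscSections.lightCone_real_sub, add_comm t ε]

end Summit.QuantumFields.YangMills.Cruxes.ShellRigidity.TransverseSmearingPlanarThreshold
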